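import Summits.Ventures.DiscreteObjects.UnitDistance.PlaneSqrt11Graph
import Summits.Ventures.DiscreteObjects.UnitDistance.PlaneSqrt23Four
import Summits.Ventures.DiscreteObjects.UnitDistance.PlaneSqrt71Four
import HarnessLib

/-!
# Quadratic planes with chromatic number four: `d = 11, 23, 71` (cell `pub-namedobj`, target (U), seat udg g12 — summary)

Framing (verbatim for the cell): lottery ticket; floor = certified bounds/negative ranges.

The cell's quadratic table (`QuadraticFieldsAtlas.lean`, udg g11) listed `χ(ℚ(√d)²) ∈ {3, 4}` for `d = 11, 23, 35` (and, beyond 40, for every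
`d ≡ 3 (mod 4)` with `d ≡ 2 (mod 3)` admitting a 2-adic or 7-adic bound).  Three of these rows are now exact: `χ(ℚ(√d)²) = 4` for `d = 11, 23, 71`,
each by an explicit triangle-free unit-distance graph with coordinates in `ℚ(√d)` that is not 3-colourable in the kernel (109 / 295 / 193 vertices;
backtracking search for `d = 11`, kernel RUP certificates for all three).  Every unit-distance graph over these fields is triangle-free
(`TriangleFreeFieldPlanes.lean`), and every 3-colouring argument by reduction modulo one prime needs a residue field `𝔽₃` (absent here:
`d ≡ 2 (mod 3)`), so neither classical bound was sharp.  Still open in the table: `d = 35, 59, 95, …` (balls of radius `3` in the natural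
generators are 3-colourable; no certificate either way).  Values not found in print (PROVISIONAL).
-/

noncomputable section

namespace Summit.Ventures.DiscreteObjects.UnitDistance

open SimpleGraph IntermediateField
open scoped IntermediateField

/-- THREE EXACT QUADRATIC ROWS: `χ(ℚ(√11)²) = χ(ℚ(√23)²) = χ(ℚ(√71)²) = 4`. -/
theorem chromaticNumber_plane_sqrt_11_23_71 :
    (planeUnitDistanceGraph.induce (fieldPoints ℚ⟮Real.sqrt 11⟯)).chromaticNumber = 4 ∧
    (planeUnitDistanceGraph.induce (fieldPoints ℚ⟮Real.sqrt 23⟯)).chromaticNumber = 4 ∧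
    (planeUnitDistanceGraph.induce (fieldPoints ℚ⟮Real.sqrt 71⟯)).chromaticNumber = 4 :=
  ⟨chromaticNumber_plane_sqrt11, chromaticNumber_plane_sqrt23, chromaticNumber_plane_sqrt71⟩

/-- Atlas form (the cell's `multiSqrtField` vocabulary). -/
theorem chromaticNumber_plane_multiSqrtField_11_23_71 :
    ∀ d ∈ ({11, 23, 71} : Finset ℕ), (planeUnitDistanceGraph.induce (fieldPoints (multiSqrtField {d}))).chromaticNumber = 4 := by
  intro d hd
  simp only [Finset.mem_insert, Finset.mem_singleton] at hd
  rcases hd with rfl | rfl | rfl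
  · exact chromaticNumber_plane_multiSqrtField_11
  · exact chromaticNumber_plane_multiSqrtField_23
  · exact chromaticNumber_plane_multiSqrtField_71

/-- The three witnesses are triangle-free and not 3-colourable (`χ = 4` exactly for `W₁₁`, `W₇₁`; for `W₂₃` the explicit 4-colouring
is not kernel-checked, `χ(W₂₃) ≤ 4` follows from the realisation). -/
theorem witnesses_triangleFree_not_three_colourable :
    (w11Graph.CliqueFree 3 ∧ w11Graph.chromaticNumber = 4) ∧
    (w23Graph.CliqueFree 3 ∧ ¬ w23Graph.Colorable 3) ∧
    (w71Graph.CliqueFree 3 ∧ w71Graph.chromaticNumber = 4) := by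
  refine ⟨⟨w11Graph_cliqueFree_three, chromaticNumber_w11Graph⟩, ⟨?_, not_colorable_three_w23Graph⟩, ⟨?_, chromaticNumber_w71Graph⟩⟩
  · -- a triangle of `W₂₃` would map by the realisation homomorphism to a unit triangle of `ℚ(√23)²`
    intro s hs
    rw [is3Clique_iff] at hs
    obtain ⟨a, b, c, hab, hac, hbc, -⟩ := hs
    exact cliqueFree_three_plane_sqrt_7_23_35.2.1 _
      (is3Clique_triple_iff.2 ⟨w23Hom.map_rel hab, w23Hom.map_rel hac, w23Hom.map_rel hbc⟩)
  · intro s hs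
    rw [is3Clique_iff] at hs
    obtain ⟨a, b, c, hab, hac, hbc, -⟩ := hs
    have h71 : Real.sqrt 3 ∉ ℚ⟮Real.sqrt 71⟯ := by
      have h213 : Irrational (Real.sqrt ((213 : ℕ) : ℝ)) :=
        irrational_sqrt_natCast_iff.2 (not_isSquare_of_between (r := 14) (by norm_num) (by norm_num))
      have h := sqrt3_not_mem_adjoin_sqrt 71 (by norm_num : Nat.Prime 71).irrational_sqrt
        (by convert h213 using 2; push_cast; norm_num)
      rw [Nat.cast_ofNat] at h
      exact h
    exact cliqueFree_three_plane_of_sqrt3_not_mem _ h71 _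
      (is3Clique_triple_iff.2 ⟨w71Hom.map_rel hab, w71Hom.map_rel hac, w71Hom.map_rel hbc⟩)

end Summit.Ventures.DiscreteObjects.UnitDistance
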